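import Mathlib.Analysis.SpecificLimits.Basic
import Mathlib.Analysis.SpecialFunctions.Pow.Real
import HarnessLib

/-!
# K1L_D (stmt-AnomalousDissipation-27980), stub S23″: the GEOMETRIC RECURSION of the high-label content (S3′ brick, L4c §3.4)
# (helper; `--supports … --as helper`)

In the label-split ledger (p4 g12 L4c §3 / lead F-lead-9) the high-label content `h_j` of the true state obeys, window after window,
`√H_{j+1} ≤ φ·√H_j + s_j` with a contraction `φ < 1` ((M♭_G) beyond the homogenisation range, the tracking floor inside it) and sources `s_j`
(reset-scrambled corrector deposits, hopped content).  This file records the elementary consequence `a_j ≤ φ^j a_0 + (Σ_{i<j} φ^{j−1−i} s_i)` and its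
sup-form `a_j ≤ φ^j a_0 + S/(1−φ)` for `s_i ≤ S`.  Pure real algebra.  Infrastructure for rung F-D1.A0; NOT a proof of the crux or of anomalous dissipation.
-/

set_option linter.dupNamespace false

namespace Summit.AnomalousDissipation.AnomalousDissipation.Theorems.SolenoidalFractalHomogenisation.LagrangianStep

open Finset

/-- **Geometric recursion, sup form.**  If `0 ≤ φ < 1`, `a (j+1) ≤ φ·a j + s j` and `0 ≤ s j ≤ S` for all `j`, then
`a j ≤ φ^j · a 0 + S / (1 − φ)` for all `j`. -/
theorem geom_recursion_le (a s : ℕ → ℝ) {φ S : ℝ} (hφ0 : 0 ≤ φ) (hφ1 : φ < 1) (hS : ∀ j, s j ≤ S) (hs0 : ∀ j, 0 ≤ s j)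
    (hstep : ∀ j, a (j + 1) ≤ φ * a j + s j) : ∀ j, a j ≤ φ ^ j * a 0 + S / (1 - φ) := by
  have hS0 : 0 ≤ S := (hs0 0).trans (hS 0)
  have h1φ : 0 < 1 - φ := by linarith
  have hSφ : 0 ≤ S / (1 - φ) := div_nonneg hS0 h1φ.le
  intro j
  induction j with
  | zero => simpa using hSφ
  | succ j ih =>
    have hkey : φ * (S / (1 - φ)) + S = S / (1 - φ) := by
      field_simp
      ring
    calc a (j + 1) ≤ φ * a j + s j := hstep j
      _ ≤ φ * (φ ^ j * a 0 + S / (1 - φ)) + S := add_le_add (mul_le_mul_of_nonneg_left ih hφ0) (hS j)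
      _ = φ ^ (j + 1) * a 0 + (φ * (S / (1 - φ)) + S) := by ring
      _ = φ ^ (j + 1) * a 0 + S / (1 - φ) := by rw [hkey]

/-- **Geometric recursion with contraction `φ ≤ 1/2`**: `a j ≤ a 0 / 2^j + 2S`. -/
theorem geom_recursion_le_half (a s : ℕ → ℝ) {φ S : ℝ} (hφ0 : 0 ≤ φ) (hφ : φ ≤ 1 / 2) (ha0 : 0 ≤ a 0) (hS : ∀ j, s j ≤ S)
    (hs0 : ∀ j, 0 ≤ s j) (hstep : ∀ j, a (j + 1) ≤ φ * a j + s j) (j : ℕ) : a j ≤ a 0 / 2 ^ j + 2 * S := by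
  have h := geom_recursion_le a s hφ0 (by linarith) hS hs0 hstep j
  have hS0 : 0 ≤ S := (hs0 0).trans (hS 0)
  have hpow : φ ^ j ≤ (1 / 2) ^ j := pow_le_pow_left₀ hφ0 hφ j
  have h1 : φ ^ j * a 0 ≤ a 0 / 2 ^ j := by
    calc φ ^ j * a 0 ≤ (1 / 2) ^ j * a 0 := mul_le_mul_of_nonneg_right hpow ha0
      _ = a 0 / 2 ^ j := by rw [one_div_pow]; ring
  have h2 : S / (1 - φ) ≤ 2 * S := by
    rw [div_le_iff₀ (by linarith)]; nlinarith
  linarith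

/-- **Energy form of the recursion** (`H_{j+1} ≤ φ² … ` is awkward; the amplitude form is what one proves): if `√H_{j+1} ≤ φ √H_j + s_j` with `H ≥ 0`,
`0 ≤ φ ≤ 1/2`, `0 ≤ s_j ≤ S`, then `√H_j ≤ √H_0 / 2^j + 2S`, hence `H_j ≤ 2·H_0/4^j + 8S²`. -/
theorem energy_recursion_le (H s : ℕ → ℝ) {φ S : ℝ} (hφ0 : 0 ≤ φ) (hφ : φ ≤ 1 / 2) (hH : ∀ j, 0 ≤ H j) (hS : ∀ j, s j ≤ S)
    (hs0 : ∀ j, 0 ≤ s j) (hstep : ∀ j, Real.sqrt (H (j + 1)) ≤ φ * Real.sqrt (H j) + s j) (j : ℕ) :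
    H j ≤ 2 * H 0 / 4 ^ j + 8 * S ^ 2 := by
  have h := geom_recursion_le_half (fun j => Real.sqrt (H j)) s hφ0 hφ (Real.sqrt_nonneg _) hS hs0 hstep j
  have hS0 : 0 ≤ S := (hs0 0).trans (hS 0)
  have hsq : H j = Real.sqrt (H j) ^ 2 := (Real.sq_sqrt (hH j)).symm
  have hA : 0 ≤ Real.sqrt (H 0) / 2 ^ j := by positivity
  -- `(A + 2S)² ≤ 2A² + 8S²`
  have h2 : Real.sqrt (H j) ^ 2 ≤ (Real.sqrt (H 0) / 2 ^ j + 2 * S) ^ 2 :=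
    pow_le_pow_left₀ (Real.sqrt_nonneg _) h 2
  have h3 : (Real.sqrt (H 0) / 2 ^ j + 2 * S) ^ 2 ≤ 2 * (Real.sqrt (H 0) / 2 ^ j) ^ 2 + 8 * S ^ 2 := by
    nlinarith [sq_nonneg (Real.sqrt (H 0) / 2 ^ j - 2 * S)]
  have h4 : (Real.sqrt (H 0) / 2 ^ j) ^ 2 = H 0 / 4 ^ j := by
    rw [div_pow, Real.sq_sqrt (hH 0)]
    congr 1
    rw [← pow_mul, show (4:ℝ) = 2 ^ 2 by norm_num, ← pow_mul, mul_comm]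
  rw [hsq]
  calc Real.sqrt (H j) ^ 2 ≤ (Real.sqrt (H 0) / 2 ^ j + 2 * S) ^ 2 := h2
    _ ≤ 2 * (Real.sqrt (H 0) / 2 ^ j) ^ 2 + 8 * S ^ 2 := h3
    _ = 2 * H 0 / 4 ^ j + 8 * S ^ 2 := by rw [h4]; ring

end Summit.AnomalousDissipation.AnomalousDissipation.Theorems.SolenoidalFractalHomogenisation.LagrangianStep
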